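import Mathlib
import HarnessLib

/-!
# Far-transmission helpers for line `thermalise-then-cut-probe-insertion` (crux stmt-AtomisticToContinuum-11748)

Closed, fixed-`N`, pure-real facts around the registered stub `stub_farTransmission`
(`0 ≤ bypass g ∧ bypass g ≤ c · G_N · G_M`) of the skeleton
`Cruxes/SuperadditiveResistance/Lines/thermalise-then-cut-probe-insertion.lean`:

* `laplacianForm_eq` — the four-terminal entropy form `Σ_a Σ_b g_ab (θ_a − θ_b)²` of a symmetric `g`
  in its six-edge shape (the skeleton's `dirichletForm_eq`, stated over the raw sum so that it applies to
  `dirichletForm g θ` by unfolding);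
* `transfer_sq_le_self_mul_self`, `abs_transfer_le` — what symmetry + non-negativity of the entropy
  form DO give about the bypass `x = g 0 3`: `x² ≤ L₁₁ · L₄₄` (the `2 × 2` principal minor of the
  response matrix) and `|x| ≤ (L₁₁ + L₄₄)/2`;
* `exists_psd_transfer_neg` — and what they do NOT give: a symmetric `g` with non-negative entropy form
  and `g 0 3 < 0` (all transfer conductances `1` except `g 0 3 = g 3 0 = −1/2`), so the SIGN clause
  `0 ≤ bypass g` is not a consequence of the algebraic part of `DeviceFrame`;
* `core_estimate_unsigned` (`'`: named-hypothesis form) — the skeleton's real-analysis core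
  `core_estimate` WITHOUT the sign
  hypothesis `0 ≤ x` (and without `0 ≤ a`, `0 ≤ b`): only the UPPER bound `x ≤ c · gN · gM` on the
  bypass is load-bearing, at the price `2K → 4K` in the constant. The step `U ≥ m/2` (the only use of
  `0 ≤ x`) is replaced by the case split `m ≤ 4U` (then `K m / U ≤ 4K`) or `4U < m` (then
  `1/gL ≥ (1 − Km)/U ≥ 1/(2U) > 2/m ≥ 1/A + 1/B`).

Conventions as in the skeleton: terminals `0,1,2,3`; `a = L₁₁ = g 0 1 + g 0 2 + g 0 3`,
`b = L₄₄ = g 0 3 + g 1 3 + g 2 3`, `x = g 0 3`.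
-/

namespace Summit.AtomisticToContinuum.FouriersLaw.Cruxes.SuperadditiveResistance.ThermaliseThenCutProbeInsertion.FarTransmission

open Finset

variable {g : Fin 4 → Fin 4 → ℝ}

/-- Six-edge shape of the four-terminal entropy-production form of a symmetric `g`. -/
theorem laplacianForm_eq (hsym : ∀ a b, g a b = g b a) (θ : Fin 4 → ℝ) :
    ∑ a, ∑ b, g a b * (θ a - θ b) ^ 2 = 2 * (g 0 1 * (θ 0 - θ 1) ^ 2 + g 0 2 * (θ 0 - θ 2) ^ 2 +
      g 0 3 * (θ 0 - θ 3) ^ 2 + g 1 2 * (θ 1 - θ 2) ^ 2 + g 1 3 * (θ 1 - θ 3) ^ 2 +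
      g 2 3 * (θ 2 - θ 3) ^ 2) := by
  simp only [Fin.sum_univ_four]
  rw [hsym 1 0, hsym 2 0, hsym 3 0, hsym 2 1, hsym 3 1, hsym 3 2]
  ring

/-- The entropy form restricted to the two END terminals (`θ = (s, 0, 0, t)`) is the binary form
`a s² − 2 x s t + b t²` of the `2 × 2` principal block `[[L₁₁, −x], [−x, L₄₄]]`. -/
theorem laplacianForm_ends (hsym : ∀ a b, g a b = g b a) (s t : ℝ) :
    ∑ a, ∑ b, g a b * ((![s, 0, 0, t] : Fin 4 → ℝ) a - (![s, 0, 0, t] : Fin 4 → ℝ) b) ^ 2 =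
      2 * ((g 0 1 + g 0 2 + g 0 3) * s ^ 2 - 2 * g 0 3 * s * t + (g 0 3 + g 1 3 + g 2 3) * t ^ 2) := by
  rw [laplacianForm_eq hsym]
  simp
  ring

/-- PSD consequence for the bypass: `x² ≤ L₁₁ · L₄₄` (non-negativity of the `2 × 2` principal minor
of the symmetric response matrix on the two end terminals). -/
theorem transfer_sq_le_self_mul_self (hsym : ∀ a b, g a b = g b a)
    (hpsd : ∀ θ : Fin 4 → ℝ, 0 ≤ ∑ a, ∑ b, g a b * (θ a - θ b) ^ 2) :
    (g 0 3) ^ 2 ≤ (g 0 1 + g 0 2 + g 0 3) * (g 0 3 + g 1 3 + g 2 3) := by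
  -- the quadratic `s ↦ a s² − 2x s + b` is non-negative, so its discriminant `4x² − 4ab` is `≤ 0`
  have hq : ∀ s : ℝ, 0 ≤ (g 0 1 + g 0 2 + g 0 3) * (s * s) + (-(2 * g 0 3)) * s +
      (g 0 3 + g 1 3 + g 2 3) := by
    intro s
    have h := hpsd ![s, 0, 0, 1]
    rw [laplacianForm_ends hsym] at h
    nlinarith [h]
  have hd := discrim_le_zero hq
  rw [discrim] at hd
  nlinarith [hd]

/-- PSD consequence for the bypass, linear form: `|x| ≤ (L₁₁ + L₄₄)/2` (an `O(G)` bound — one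
conductance factor short of the stub's `O(G_N G_M)`). -/
theorem abs_transfer_le (hsym : ∀ a b, g a b = g b a)
    (hpsd : ∀ θ : Fin 4 → ℝ, 0 ≤ ∑ a, ∑ b, g a b * (θ a - θ b) ^ 2) :
    |g 0 3| ≤ ((g 0 1 + g 0 2 + g 0 3) + (g 0 3 + g 1 3 + g 2 3)) / 2 := by
  have hsq := transfer_sq_le_self_mul_self hsym hpsd
  have ha : 0 ≤ g 0 1 + g 0 2 + g 0 3 := by
    have h := hpsd ![1, 0, 0, 0]
    rw [laplacianForm_eq hsym] at h
    simp at h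
    linarith
  have hb : 0 ≤ g 0 3 + g 1 3 + g 2 3 := by
    have h := hpsd ![0, 0, 0, 1]
    rw [laplacianForm_eq hsym] at h
    simp at h
    linarith
  refine abs_le_of_sq_le_sq ?_ (by positivity)
  nlinarith [sq_nonneg ((g 0 1 + g 0 2 + g 0 3) - (g 0 3 + g 1 3 + g 2 3))]

/-- The sign of the bypass is NOT decided by symmetry + non-negative entropy production: the weighted
`K₄`-Laplacian with weights `1` on five edges and `−1/2` on the edge `{0, 3}` is positive semidefinite
(`L_{K₄} − s · L_{edge} ⪰ 0` iff `s ≤ 2`), yet its `{0,3}` transfer conductance is negative. -/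
theorem exists_psd_transfer_neg :
    ∃ g : Fin 4 → Fin 4 → ℝ, (∀ a b, g a b = g b a) ∧
      (∀ θ : Fin 4 → ℝ, 0 ≤ ∑ a, ∑ b, g a b * (θ a - θ b) ^ 2) ∧ g 0 3 < 0 := by
  refine ⟨fun a b => if a = b then 0 else if a.val + b.val = 3 ∧ (a.val = 0 ∨ b.val = 0) then -1/2
    else 1, ?_, ?_, ?_⟩
  · intro a b
    fin_cases a <;> fin_cases b <;> simp
  · intro θ
    have hsym : ∀ a b : Fin 4, (fun a b : Fin 4 => if a = b then (0 : ℝ) else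
        if a.val + b.val = 3 ∧ (a.val = 0 ∨ b.val = 0) then -1/2 else 1) a b =
        (fun a b : Fin 4 => if a = b then (0 : ℝ) else
        if a.val + b.val = 3 ∧ (a.val = 0 ∨ b.val = 0) then -1/2 else 1) b a := by
      intro a b
      fin_cases a <;> fin_cases b <;> simp
    rw [laplacianForm_eq hsym]
    simp
    nlinarith [sq_nonneg (θ 0 - 2 * θ 1 + θ 3), sq_nonneg (θ 0 - θ 2), sq_nonneg (θ 1 - θ 2),
      sq_nonneg (θ 2 - θ 3)]
  · show (if (0 : Fin 4) = 3 then (0 : ℝ) else if (0 : Fin 4).val + (3 : Fin 4).val = 3 ∧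
        ((0 : Fin 4).val = 0 ∨ (3 : Fin 4).val = 0) then -1/2 else 1) < 0
    rw [if_neg (by decide), if_pos (by decide)]
    norm_num

/-- CORE ESTIMATE WITHOUT THE SIGN OF THE BYPASS. `gN, gM, gL`: conductances of the pieces and of the
whole; `a, b, x`: device end self-conductances and bypass; `Gd`: floating device conductance.
Hypotheses: the one-sided termination bounds `a ≤ gN(1 + c gN)`, `b ≤ gM(1 + c gM)`, the one-sided
far-transmission bound `x ≤ c gN gM` (NO lower bound on `x`), the insertion bound
`gL − Gd ≤ K · min(a,b) · gL` and the Dirichlet principle. Conclusion: the crux inequality with the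
constant `4c + 4K + 4K(1+c) + 2` (the signed version `core_estimate` of the skeleton has `2K` in
place of `4K`). -/
theorem core_estimate_unsigned' {gN gM gL a b x Gd K c : ℝ} (hGN : 0 < gN) (hGM : 0 < gM)
    (hGL : 0 < gL) (hK : 0 ≤ K) (hc : 0 ≤ c)
    (ha : a ≤ gN * (1 + c * gN)) (hb : b ≤ gM * (1 + c * gM)) (hx : x ≤ c * gN * gM)
    (hα : gL - Gd ≤ K * min a b * gL)
    (hDir : ∀ θ : ℝ, Gd ≤ (a - x) * (1 / 2 - θ) ^ 2 + (b - x) * (1 / 2 + θ) ^ 2 + x) :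
    1 / gN + 1 / gM - (4 * c + 4 * K + 4 * K * (1 + c) + 2) ≤ 1 / gL := by
  have ha' := ha
  have hb' := hb
  -- name the composite quantities (opaque variables keep the terms small)
  obtain ⟨A, hA⟩ : ∃ A : ℝ, A = gN * (1 + c * gN) := ⟨_, rfl⟩
  obtain ⟨B, hB⟩ : ∃ B : ℝ, B = gM * (1 + c * gM) := ⟨_, rfl⟩
  obtain ⟨X, hX⟩ : ∃ X : ℝ, X = c * gN * gM := ⟨_, rfl⟩
  obtain ⟨m, hm⟩ : ∃ m : ℝ, m = min a b := ⟨_, rfl⟩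
  rw [← hA] at ha
  rw [← hB] at hb
  rw [← hX] at hx
  rw [← hm] at hα
  have hA0 : 0 < A := by rw [hA]; positivity
  have hB0 : 0 < B := by rw [hB]; positivity
  have hX0 : 0 ≤ X := by rw [hX]; positivity
  have hma : m ≤ a := by rw [hm]; exact min_le_left a b
  have hmb : m ≤ b := by rw [hm]; exact min_le_right a b
  have hgNA : gN ≤ A := by rw [hA]; nlinarith [mul_nonneg hc (mul_pos hGN hGN).le]
  have hgMB : gM ≤ B := by rw [hB]; nlinarith [mul_nonneg hc (mul_pos hGM hGM).le]
  have hGLinv : 0 < 1 / gL := by positivity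
  -- reciprocal bounds for the pieces
  have hinvA : 1 / gN - c ≤ 1 / A := by
    have e : 1 / A = 1 / gN - c / (1 + c * gN) := by
      rw [hA]
      field_simp
      ring
    rw [e]
    have : c / (1 + c * gN) ≤ c := div_le_self hc (by nlinarith [mul_nonneg hc hGN.le])
    linarith
  have hinvB : 1 / gM - c ≤ 1 / B := by
    have e : 1 / B = 1 / gM - c / (1 + c * gM) := by
      rw [hB]
      field_simp
      ring
    rw [e]
    have : c / (1 + c * gM) ≤ c := div_le_self hc (by nlinarith [mul_nonneg hc hGM.le])
    linarith
  -- a short piece has small resistance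
  have hshort : ∀ {G s κ : ℝ}, 0 < G → s ≤ G * (1 + c * G) → 0 < κ → κ < s →
      1 / G ≤ (1 + c) / κ + 1 := by
    intro G s κ hG hs hκ hκs
    have hpos : 0 ≤ (1 + c) / κ := by positivity
    rcases le_or_gt 1 G with hG1 | hG1
    · have h1 : 1 / G ≤ 1 := by rw [div_le_one hG]; exact hG1
      linarith
    · have h3 : G * (1 + c * G) ≤ G * (1 + c) := by
        apply mul_le_mul_of_nonneg_left _ hG.le
        nlinarith [mul_le_mul_of_nonneg_left hG1.le hc]
      have h4 : κ < G * (1 + c) := by linarith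
      have h5 : 1 / G ≤ (1 + c) / κ := by
        rw [div_le_div_iff₀ hG hκ]
        linarith
      linarith
  have hK' : 0 ≤ 4 * K * (1 + c) + 2 := by positivity
  by_cases hreg : K * m ≤ 1 / 2
  · -- NON-TRIVIAL REGIME
    have hAB : 0 < A + B := by positivity
    obtain ⟨U, hUdef⟩ :
        ∃ U : ℝ, U = (a * B ^ 2 + b * A ^ 2 + 2 * x * A * B) / (A + B) ^ 2 := ⟨_, rfl⟩
    -- the Dirichlet value at the trial node temperature θ₀ = (A − B)/(2(A+B)) is U
    have hUeq : (a - x) * (1 / 2 - (A - B) / (2 * (A + B))) ^ 2 +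
        (b - x) * (1 / 2 + (A - B) / (2 * (A + B))) ^ 2 + x = U := by
      rw [hUdef]
      field_simp
      ring
    have hGdU : Gd ≤ U := by rw [← hUeq]; exact hDir _
    -- U ≤ A B (A + B + 2X)/(A+B)²  (uses only the UPPER bounds on a, b, x)
    have hUup : U ≤ A * B * (A + B + 2 * X) / (A + B) ^ 2 := by
      rw [hUdef]
      apply div_le_div_of_nonneg_right _ (by positivity)
      have h1 : a * B ^ 2 ≤ A * B ^ 2 := mul_le_mul_of_nonneg_right ha (sq_nonneg B)
      have h2 : b * A ^ 2 ≤ B * A ^ 2 := mul_le_mul_of_nonneg_right hb (sq_nonneg A)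
      have hAB' : 0 ≤ 2 * A * B := by positivity
      have h3 : 2 * A * B * x ≤ 2 * A * B * X := mul_le_mul_of_nonneg_left hx hAB'
      linarith
    -- α-leg: gL (1 − K m) ≤ Gd ≤ U
    have h1 : gL * (1 - K * m) ≤ U := by linarith
    have hUpos : 0 < U := by
      have : 0 < gL * (1 - K * m) := mul_pos hGL (by linarith)
      linarith
    have h2 : (1 - K * m) / U ≤ 1 / gL := by
      rw [div_le_div_iff₀ hUpos hGL]
      linarith
    -- β-leg: 1/U ≥ (A+B)²/(AB(A+B+2X)) ≥ 1/A + 1/B − 2X/(AB) ≥ 1/gN + 1/gM − 4c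
    have h4 : (A + B) ^ 2 / (A * B * (A + B + 2 * X)) ≤ 1 / U := by
      have := one_div_le_one_div_of_le hUpos hUup
      rw [one_div_div] at this
      exact this
    have h5 : (A + B - 2 * X) / (A * B) ≤ (A + B) ^ 2 / (A * B * (A + B + 2 * X)) := by
      rw [div_le_div_iff₀ (by positivity) (by positivity)]
      have hAB2 : 0 ≤ A * B * X ^ 2 := by positivity
      linarith
    have h6 : 1 / gN + 1 / gM - 4 * c ≤ (A + B - 2 * X) / (A * B) := by
      have hX' : 2 * X / (A * B) ≤ 2 * c := by
        rw [div_le_iff₀ (by positivity), hX]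
        have : gN * gM ≤ A * B := mul_le_mul hgNA hgMB hGM.le hA0.le
        have hc2 : (0:ℝ) ≤ 2 * c := by positivity
        have := mul_le_mul_of_nonneg_left this hc2
        linarith
      have hsplit : (A + B - 2 * X) / (A * B) = 1 / A + 1 / B - 2 * X / (A * B) := by
        field_simp
        ring
      rw [hsplit]
      linarith
    rcases le_or_gt m (4 * U) with hmU | hmU
    · -- CASE m ≤ 4U: K m / U ≤ 4 K, and the β-leg bound on 1/U
      have h3 : 1 / U - 4 * K ≤ (1 - K * m) / U := by
        have h31 : K * m / U ≤ 4 * K := by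
          rw [div_le_iff₀ hUpos]
          have : K * m ≤ K * (4 * U) := mul_le_mul_of_nonneg_left hmU hK
          linarith
        have h32 : (1 - K * m) / U = 1 / U - K * m / U := by rw [sub_div]
        linarith
      linarith
    · -- CASE 4U < m: the whole chain conducts less than a quarter of the smaller end
      -- self-conductance, so 1/gL ≥ (1 − Km)/U ≥ 1/(2U) > 2/m ≥ 1/A + 1/B
      have hm0 : 0 < m := by linarith
      have h3 : 1 / (2 * U) ≤ (1 - K * m) / U := by
        rw [div_le_div_iff₀ (by positivity) hUpos]
        nlinarith [mul_nonneg hUpos.le (by linarith : (0:ℝ) ≤ 1 - 2 * (K * m))]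
      have h7 : 2 / m ≤ 1 / (2 * U) := by
        rw [div_le_div_iff₀ hm0 (by positivity)]
        linarith
      have h8 : 1 / A ≤ 1 / m := one_div_le_one_div_of_le hm0 (hma.trans ha)
      have h9 : 1 / B ≤ 1 / m := one_div_le_one_div_of_le hm0 (hmb.trans hb)
      have h10 : 2 / m = 1 / m + 1 / m := by ring
      have hK4 : 0 ≤ 4 * K := by positivity
      linarith
  · -- TRIVIAL REGIME: both pieces are short
    push Not at hreg
    have hKpos : 0 < K := by
      rcases hK.eq_or_lt with h | h
      · rw [← h] at hreg; linarith
      · exact h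
    have hmpos : 1 / (2 * K) < m := by
      rw [div_lt_iff₀ (by positivity)]
      linarith
    have hκ : 0 < 1 / (2 * K) := by positivity
    have hN' := hshort hGN ha' hκ (lt_of_lt_of_le hmpos hma)
    have hM' := hshort hGM hb' hκ (lt_of_lt_of_le hmpos hmb)
    have hsimp : (1 + c) / (1 / (2 * K)) = 2 * K * (1 + c) := by
      field_simp
    rw [hsimp] at hN' hM'
    have hK4 : 0 ≤ 4 * K := by positivity
    linarith

/-- `core_estimate_unsigned'` in the registered (`∀`-chain) shape of the sub-goal stub
`core_estimate_unsigned` of crux stmt-AtomisticToContinuum-11748. -/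
theorem core_estimate_unsigned : ∀ {gN gM gL a b x Gd K c : ℝ}, 0 < gN → 0 < gM → 0 < gL → 0 ≤ K →
    0 ≤ c → a ≤ gN * (1 + c * gN) → b ≤ gM * (1 + c * gM) → x ≤ c * gN * gM →
    gL - Gd ≤ K * min a b * gL →
    (∀ θ : ℝ, Gd ≤ (a - x) * (1 / 2 - θ) ^ 2 + (b - x) * (1 / 2 + θ) ^ 2 + x) →
    1 / gN + 1 / gM - (4 * c + 4 * K + 4 * K * (1 + c) + 2) ≤ 1 / gL :=
  fun hGN hGM hGL hK hc ha hb hx hα hDir => core_estimate_unsigned' hGN hGM hGL hK hc ha hb hx hα hDir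

end Summit.AtomisticToContinuum.FouriersLaw.Cruxes.SuperadditiveResistance.ThermaliseThenCutProbeInsertion.FarTransmission
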